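import Mathlib
import HarnessLib.Audit
import Summits.PneNP.PneNP.Theorems.PstarUnionCaseAFive

/-!
# `UnionFive` = Case A + Case B; Case A is closed, Case B is the one open node (ROUND-24, memo §14.21; typed sketch `r24/SketchCaseB.lean` of planner p3 g22)

FRONTIER range-avoidance ladder, rung F-N3, ROUND 24 (cell `pnp-ideate`, planner memo `r24/CORE-BOUND-NOTES.md` §14.21; definition `CaseBFive` and the glue `unionFive_of_cases`
VERBATIM from planner p3 g22's `r24/SketchCaseB.lean` (20:33Z); restricted-model proof complexity — nothing here bears on `P` versus `NP`).

* `CaseBFive` (OPEN, `@[conjecture]`) — the Case-B target: union-terminal + admissible `F` + hun + `w₂` READS SOME CHORD PRIVATE ⟹ `#J₀ ≤ 5`;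
* `unionFive_of_cases : CaseAFive → CaseBFive → UnionFive` — the split on whether `w₂` reads a chord private;
* `unionFive_of_caseBFive : CaseBFive → UnionFive` — with `PstarUnionCaseAFive.caseAFive_holds` plugged in: **`UnionFive` is reduced to the single open node `CaseBFive`.**

Structure available for Case B: B6–B8 (`PstarUnionCaseB`), CORE (`PstarUnionChordPair.chordPair_surjective`), B-I (`PstarUnionCaseBReads.chords_read_of_one`), B-II
(`PstarUnionCaseBAlign.alignment`); remaining: the kernel conditions B-III and the counts (memo §14.21–§14.25).
-/

set_option linter.dupNamespace false -- `Summit.PneNP.PneNP.…`: summit = sub-problem name (D-0017 single-conjunct layout)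

open Finset Literature.Computability.Complexity
open Summit.PneNP.PneNP.Theorems.PstarTyped (Typed)
open Summit.PneNP.PneNP.Theorems.PstarSALevel (BoundaryExpanding SimpleOverlap)
open Summit.PneNP.PneNP.Theorems.PstarChordRepair (IsChord)
open Summit.PneNP.PneNP.Theorems.PstarChordBridgeCotree (Peelable)
open Summit.PneNP.PneNP.Theorems.PstarChordBridgeTools (privs)
open Summit.PneNP.PneNP.Theorems.PstarUnion (UnionTerminal UnionFive)
open Summit.PneNP.PneNP.Theorems.PstarUnionAtoms (CaseAFive)
open Summit.PneNP.PneNP.Theorems.PstarUnionCaseAFive (caseAFive_holds)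

namespace Summit.PneNP.PneNP.Theorems.PstarUnionCases

/-- **CASE-B TARGET (OPEN).**  Union-terminal + admissible `F` + hun + `w₂` READS SOME CHORD PRIVATE ⟹ `#J₀ ≤ 5`.  With `CaseAFive` (`PstarUnionCaseAFive.caseAFive_holds`)
this is ALL that remains of `UnionFive` (`unionFive_of_caseBFive`).  Structure available: B-I (then `w₂` reads every chord), B-II (alignment), the kernel conditions of
memo §14.21 B-III, the single-chord twist.  FRONTIER. -/
@[conjecture] def CaseBFive : Prop :=
  ∀ (n m r : ℕ) (I : LocalMap 4 n m), I.IsPure xorAndPred → Typed I → SimpleOverlap I → BoundaryExpanding r I →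
  ∀ (y : Fin m → Bool) (J₀ : Finset (Fin m)) (A₀ A₁ w₂ : Finset (Fin n) × Finset (Fin m) × Bool),
    UnionTerminal I r y J₀ A₀ A₁ w₂ →
    ∀ F ⊆ J₀, Peelable I F → (∀ F', F ⊆ F' → F' ⊆ J₀ → Peelable I F' → F' = F) → (∀ e ∈ J₀ \ F, IsChord I J₀ e) →
    (∀ g ∈ A₀.2.1 ∪ w₂.2.1, ∀ v ∈ privs I (J₀ \ F), I.vars g 2 ≠ v ∧ I.vars g 3 ≠ v) →
    (∃ v ∈ privs I (J₀ \ F), v ∈ w₂.1) →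
    J₀.card ≤ 5

/-- **`UnionFive` = Case A + Case B** (the split on whether `w₂` reads a chord private). -/
theorem unionFive_of_cases (hA : CaseAFive) (hB : CaseBFive) : UnionFive := by
  intro n m r I hI hT hS hE y J₀ A₀ A₁ w₂ hU F hF hP hmax hchord hun
  by_cases h : ∃ v ∈ privs I (J₀ \ F), v ∈ w₂.1
  · exact hB n m r I hI hT hS hE y J₀ A₀ A₁ w₂ hU F hF hP hmax hchord hun h
  · push Not at h
    exact hA n m r I hI hT hS hE y J₀ A₀ A₁ w₂ hU F hF hP hmax hchord hun h

/-- **`UnionFive` is reduced to Case B**: `CaseBFive → UnionFive` (Case A being `PstarUnionCaseAFive.caseAFive_holds`). -/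
theorem unionFive_of_caseBFive (hB : CaseBFive) : UnionFive :=
  unionFive_of_cases caseAFive_holds hB

end Summit.PneNP.PneNP.Theorems.PstarUnionCases
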